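import Literature.GroupTheory.CombinatorialGroupTheory.PuncturedSurfaceGroupFree
import HarnessLib

/-!
# Free bases of `Γ_{g,r}` (`r ≥ 2`) containing a given puncture generator

`Γ_{g,r} = ⟨a_i, b_i, c_j ∣ [a₁,b₁]⋯[a_g,b_g]·c₁⋯c_r⟩` (abc-iut-L3-t1's `PuncturedSurfaceGroup g r`,
[SemiAnbd] Example 2.10 [cite: MochizukiSemiAnbd2006, Ex. 2.10 p.31]).  abc-iut-L5-t9 recorded that
`Γ_{g,r+1}` is free by eliminating `c₁` (`PuncturedSurfaceGroupFree.lean`, an isomorphism packaged as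
`Nonempty`).  The malnormality engine of `ProSigmaCompletionMalnormal.lean` needs, for EACH cusp `c_i`, a
free basis of `Γ_{g,r}` CONTAINING `c_i`; here we provide it for `r ≥ 2`:

* `exists_mulEquiv_freeGroup_elim_first` — `Γ_{g,r+1} ≃* F((Fin g × Bool) ⊕ Fin r)` with
  `a_i, b_i ↦` their letters and `c_{j+2} ↦ inr j` (Tietze elimination of `c₁`, with the images recorded);
* `exists_mulEquiv_freeGroup_elim_second` — `Γ_{g,r+2} ≃* F((Fin g × Bool) ⊕ Fin (r+1))` with
  `c₁ ↦ inr 0` and `c_{j+3} ↦ inr (j+1)` (Tietze elimination of `c₂ = c₁⁻¹([a₁,b₁]⋯[a_g,b_g])⁻¹(c₃⋯)⁻¹`);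
* `exists_freeGroupBasis_eq_c` — for `r ≥ 2` and every `i`, a free basis of `Γ_{g,r}` one of whose
  members is `c_i`.

(For `r = 1` the single puncture generator `c₁ = ([a₁,b₁]⋯[a_g,b_g])⁻¹` is a product of commutators and
belongs to no free basis.)  Theorems only; elementary combinatorial group theory.
-/

namespace Literature.GroupTheory.CombinatorialGroupTheory.PuncturedSurfaceGroup

variable (g r : ℕ)

/-- **`Γ_{g,r+1}` is free on `a_i, b_i, c₂, …, c_{r+1}`** (Tietze elimination of `c₁`), with the images
of the generators recorded: `a_i ↦ inl (i,false)`, `b_i ↦ inl (i,true)`, `c_{j+2} ↦ inr j`.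
[cite: MochizukiSemiAnbd2006, Ex. 2.10 p.31] -/
theorem exists_mulEquiv_freeGroup_elim_first :
    ∃ e : PuncturedSurfaceGroup g (r + 1) ≃* FreeGroup ((Fin g × Bool) ⊕ Fin r),
      (∀ i, e (a i) = FreeGroup.of (Sum.inl (i, false))) ∧
      (∀ i, e (b i) = FreeGroup.of (Sum.inl (i, true))) ∧
      ∀ j : Fin r, e (c (Fin.succ j)) = FreeGroup.of (Sum.inr j) := by
  classical
  let comm : FreeGroup (puncturedSurfaceGen g (r + 1)) :=
    ((List.finRange g).map fun i =>
      genA (r := r + 1) i * genB (r := r + 1) i * (genA (r := r + 1) i)⁻¹ *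
        (genB (r := r + 1) i)⁻¹).prod
  let cs : FreeGroup (puncturedSurfaceGen g (r + 1)) :=
    ((List.finRange r).map fun j => genC (g := g) (Fin.succ j)).prod
  have hrel_eq : relator g (r + 1) = comm * (genC (g := g) 0 * cs) := relator_succ g r
  let A : FreeGroup ((Fin g × Bool) ⊕ Fin r) := ((List.finRange g).map fun i =>
      FreeGroup.of (Sum.inl (i, false)) * FreeGroup.of (Sum.inl (i, true)) *
        (FreeGroup.of (Sum.inl (i, false)))⁻¹ * (FreeGroup.of (Sum.inl (i, true)))⁻¹).prod
  let B : FreeGroup ((Fin g × Bool) ⊕ Fin r) :=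
    ((List.finRange r).map fun j => FreeGroup.of (Sum.inr j)).prod
  let f : puncturedSurfaceGen g (r + 1) → FreeGroup ((Fin g × Bool) ⊕ Fin r) := fun x =>
    match x with
    | Sum.inl y => FreeGroup.of (Sum.inl y)
    | Sum.inr j => Fin.cases (A⁻¹ * B⁻¹) (fun j' => FreeGroup.of (Sum.inr j')) j
  have hf0 : f (Sum.inr 0) = A⁻¹ * B⁻¹ := by simp [f]
  have hfs : ∀ j : Fin r, f (Sum.inr (Fin.succ j)) = FreeGroup.of (Sum.inr j) := fun j => by simp [f]
  have hfA : FreeGroup.lift f comm = A := by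
    simp only [comm, A, map_list_prod, List.map_map, Function.comp_def, map_mul, map_inv, genA, genB,
      FreeGroup.lift_apply_of, f]
  have hfB : FreeGroup.lift f cs = B := by
    simp only [cs, B, map_list_prod, List.map_map, Function.comp_def, genC, FreeGroup.lift_apply_of, hfs]
  have hrel : ∀ w ∈ ({relator g (r + 1)} : Set (FreeGroup (puncturedSurfaceGen g (r + 1)))),
      FreeGroup.lift f w = 1 := by
    intro w hw
    rw [Set.mem_singleton_iff] at hw
    rw [hw, hrel_eq, map_mul, map_mul, hfA, hfB, genC, FreeGroup.lift_apply_of, hf0]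
    group
  let φ : PuncturedSurfaceGroup g (r + 1) →* FreeGroup ((Fin g × Bool) ⊕ Fin r) :=
    PresentedGroup.toGroup hrel
  let ψ : FreeGroup ((Fin g × Bool) ⊕ Fin r) →* PuncturedSurfaceGroup g (r + 1) :=
    FreeGroup.lift fun y =>
      match y with
      | Sum.inl x => PresentedGroup.of (Sum.inl x)
      | Sum.inr j => PresentedGroup.of (Sum.inr (Fin.succ j))
  have hψA : ψ A = PresentedGroup.mk _ comm := by
    simp only [A, comm, map_list_prod, List.map_map, Function.comp_def, map_mul, map_inv, ψ,
      FreeGroup.lift_apply_of, genA, genB]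
    rfl
  have hψB : ψ B = PresentedGroup.mk _ cs := by
    simp only [B, cs, map_list_prod, List.map_map, Function.comp_def, ψ, FreeGroup.lift_apply_of,
      genC]
    rfl
  have hc0 : (PresentedGroup.of (Sum.inr 0) : PuncturedSurfaceGroup g (r + 1)) =
      (PresentedGroup.mk _ comm)⁻¹ * (PresentedGroup.mk _ cs)⁻¹ := by
    have h1 := PresentedGroup.one_of_mem (rels := ({relator g (r + 1)} : Set _))
      (Set.mem_singleton (relator g (r + 1)))
    have h1' : PresentedGroup.mk ({relator g (r + 1)} : Set _) (comm * (genC (g := g) 0 * cs)) = 1 := by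
      rw [← hrel_eq]; exact h1
    rw [map_mul, map_mul] at h1'
    exact eq_mul_inv_of_mul_eq (eq_inv_of_mul_eq_one_right h1')
  have h₁ : ψ.comp φ = MonoidHom.id _ := by
    apply PresentedGroup.ext
    intro x
    rw [MonoidHom.comp_apply, MonoidHom.id_apply]
    change ψ (PresentedGroup.toGroup hrel (PresentedGroup.of x)) = _
    rw [PresentedGroup.toGroup.of]
    rcases x with y | j
    · simp [f, ψ]
    · refine Fin.cases ?_ (fun j' => ?_) j
      · rw [hf0, map_mul, map_inv, map_inv, hψA, hψB, hc0]
      · rw [hfs]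
        simp [ψ]
  have h₂ : φ.comp ψ = MonoidHom.id _ := by
    apply FreeGroup.ext_hom
    intro y
    rw [MonoidHom.comp_apply, MonoidHom.id_apply]
    rcases y with x | j
    · simp only [ψ, FreeGroup.lift_apply_of]
      change PresentedGroup.toGroup hrel (PresentedGroup.of (Sum.inl x)) = _
      rw [PresentedGroup.toGroup.of]
    · simp only [ψ, FreeGroup.lift_apply_of]
      change PresentedGroup.toGroup hrel (PresentedGroup.of (Sum.inr (Fin.succ j))) = _
      rw [PresentedGroup.toGroup.of, hfs]
  refine ⟨MonoidHom.toMulEquiv φ ψ h₁ h₂, fun i => ?_, fun i => ?_, fun j => ?_⟩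
  · change PresentedGroup.toGroup hrel (PresentedGroup.of (Sum.inl (i, false))) = _
    rw [PresentedGroup.toGroup.of]
  · change PresentedGroup.toGroup hrel (PresentedGroup.of (Sum.inl (i, true))) = _
    rw [PresentedGroup.toGroup.of]
  · change PresentedGroup.toGroup hrel (PresentedGroup.of (Sum.inr (Fin.succ j))) = _
    rw [PresentedGroup.toGroup.of, hfs]

/-- The relator of `Γ_{g,r+2}` with the first two puncture generators isolated:
`[a₁,b₁]⋯[a_g,b_g] · (c₁ · (c₂ · (c₃⋯c_{r+2})))`. [cite: MochizukiSemiAnbd2006, Ex. 2.10 p.31] -/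
theorem relator_succ_succ :
    relator g (r + 2) =
      ((List.finRange g).map fun i =>
          genA (r := r + 2) i * genB (r := r + 2) i * (genA (r := r + 2) i)⁻¹ *
            (genB (r := r + 2) i)⁻¹).prod *
        (genC (g := g) 0 * (genC (g := g) 1 *
          ((List.finRange r).map fun j => genC (g := g) (Fin.succ (Fin.succ j))).prod)) := by
  rw [relator, List.finRange_succ, List.finRange_succ]
  simp only [List.map_cons, List.map_map, List.prod_cons, Function.comp_def, Fin.succ_zero_eq_one]

/-- **`Γ_{g,r+2}` is free on `a_i, b_i, c₁, c₃, …, c_{r+2}`** (Tietze elimination of `c₂`), with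
`c₁ ↦ inr 0`, `c_{j+3} ↦ inr (j+1)`, `a_i, b_i ↦` their letters, and
`c₂ ↦ c₁⁻¹ ([a₁,b₁]⋯[a_g,b_g])⁻¹ (c₃⋯c_{r+2})⁻¹`. [cite: MochizukiSemiAnbd2006, Ex. 2.10 p.31] -/
theorem exists_mulEquiv_freeGroup_elim_second :
    ∃ e : PuncturedSurfaceGroup g (r + 2) ≃* FreeGroup ((Fin g × Bool) ⊕ Fin (r + 1)),
      (∀ i, e (a i) = FreeGroup.of (Sum.inl (i, false))) ∧
      (∀ i, e (b i) = FreeGroup.of (Sum.inl (i, true))) ∧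
      e (c 0) = FreeGroup.of (Sum.inr 0) ∧
      ∀ j : Fin r, e (c (Fin.succ (Fin.succ j))) = FreeGroup.of (Sum.inr (Fin.succ j)) := by
  classical
  let comm : FreeGroup (puncturedSurfaceGen g (r + 2)) :=
    ((List.finRange g).map fun i =>
      genA (r := r + 2) i * genB (r := r + 2) i * (genA (r := r + 2) i)⁻¹ *
        (genB (r := r + 2) i)⁻¹).prod
  let cs : FreeGroup (puncturedSurfaceGen g (r + 2)) :=
    ((List.finRange r).map fun j => genC (g := g) (Fin.succ (Fin.succ j))).prod
  have hrel_eq : relator g (r + 2) = comm * (genC (g := g) 0 * (genC (g := g) 1 * cs)) :=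
    relator_succ_succ g r
  let A : FreeGroup ((Fin g × Bool) ⊕ Fin (r + 1)) := ((List.finRange g).map fun i =>
      FreeGroup.of (Sum.inl (i, false)) * FreeGroup.of (Sum.inl (i, true)) *
        (FreeGroup.of (Sum.inl (i, false)))⁻¹ * (FreeGroup.of (Sum.inl (i, true)))⁻¹).prod
  let B : FreeGroup ((Fin g × Bool) ⊕ Fin (r + 1)) :=
    ((List.finRange r).map fun j => FreeGroup.of (Sum.inr (Fin.succ j))).prod
  let C0 : FreeGroup ((Fin g × Bool) ⊕ Fin (r + 1)) := FreeGroup.of (Sum.inr 0)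
  -- `c₁ ↦ inr 0`, `c₂ ↦ C0⁻¹ A⁻¹ B⁻¹`, `c_{j+3} ↦ inr (j+1)`
  let fc : Fin (r + 2) → FreeGroup ((Fin g × Bool) ⊕ Fin (r + 1)) :=
    Fin.cases C0 (Fin.cases (C0⁻¹ * A⁻¹ * B⁻¹) fun j => FreeGroup.of (Sum.inr (Fin.succ j)))
  let f : puncturedSurfaceGen g (r + 2) → FreeGroup ((Fin g × Bool) ⊕ Fin (r + 1)) := fun x =>
    match x with
    | Sum.inl y => FreeGroup.of (Sum.inl y)
    | Sum.inr j => fc j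
  have hf0 : f (Sum.inr 0) = C0 := by simp [f, fc]
  have hf1 : f (Sum.inr 1) = C0⁻¹ * A⁻¹ * B⁻¹ := by
    simp only [f, fc]
    rw [show (1 : Fin (r + 2)) = Fin.succ 0 from rfl, Fin.cases_succ, Fin.cases_zero]
  have hfs : ∀ j : Fin r, f (Sum.inr (Fin.succ (Fin.succ j))) = FreeGroup.of (Sum.inr (Fin.succ j)) :=
    fun j => by simp [f, fc]
  have hfA : FreeGroup.lift f comm = A := by
    simp only [comm, A, map_list_prod, List.map_map, Function.comp_def, map_mul, map_inv, genA, genB,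
      FreeGroup.lift_apply_of, f]
  have hfB : FreeGroup.lift f cs = B := by
    simp only [cs, B, map_list_prod, List.map_map, Function.comp_def, genC, FreeGroup.lift_apply_of, hfs]
  have hrel : ∀ w ∈ ({relator g (r + 2)} : Set (FreeGroup (puncturedSurfaceGen g (r + 2)))),
      FreeGroup.lift f w = 1 := by
    intro w hw
    rw [Set.mem_singleton_iff] at hw
    rw [hw, hrel_eq, map_mul, map_mul, map_mul, hfA, hfB, genC, genC, FreeGroup.lift_apply_of,
      FreeGroup.lift_apply_of, hf0, hf1]
    group
  let φ : PuncturedSurfaceGroup g (r + 2) →* FreeGroup ((Fin g × Bool) ⊕ Fin (r + 1)) :=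
    PresentedGroup.toGroup hrel
  -- the inverse: `inr 0 ↦ c₁`, `inr (j+1) ↦ c_{j+3}`
  let gc : Fin (r + 1) → PuncturedSurfaceGroup g (r + 2) :=
    Fin.cases (PresentedGroup.of (Sum.inr 0)) fun j => PresentedGroup.of (Sum.inr (Fin.succ (Fin.succ j)))
  let ψ : FreeGroup ((Fin g × Bool) ⊕ Fin (r + 1)) →* PuncturedSurfaceGroup g (r + 2) :=
    FreeGroup.lift fun y =>
      match y with
      | Sum.inl x => PresentedGroup.of (Sum.inl x)
      | Sum.inr j => gc j
  have hψ0 : ψ C0 = PresentedGroup.of (Sum.inr 0) := by simp [ψ, C0, gc]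
  have hψs : ∀ j : Fin r, ψ (FreeGroup.of (Sum.inr (Fin.succ j))) =
      PresentedGroup.of (Sum.inr (Fin.succ (Fin.succ j))) := fun j => by simp [ψ, gc]
  have hψA : ψ A = PresentedGroup.mk _ comm := by
    simp only [A, comm, map_list_prod, List.map_map, Function.comp_def, map_mul, map_inv, ψ,
      FreeGroup.lift_apply_of, genA, genB]
    rfl
  have hψB : ψ B = PresentedGroup.mk _ cs := by
    simp only [B, cs, map_list_prod, List.map_map, Function.comp_def, hψs, genC]
    rfl
  have hc1 : (PresentedGroup.of (Sum.inr 1) : PuncturedSurfaceGroup g (r + 2)) =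
      (PresentedGroup.of (Sum.inr 0))⁻¹ * (PresentedGroup.mk _ comm)⁻¹ * (PresentedGroup.mk _ cs)⁻¹ := by
    have h1 := PresentedGroup.one_of_mem (rels := ({relator g (r + 2)} : Set _))
      (Set.mem_singleton (relator g (r + 2)))
    have h1' : PresentedGroup.mk ({relator g (r + 2)} : Set _)
        (comm * (genC (g := g) 0 * (genC (g := g) 1 * cs))) = 1 := by
      rw [← hrel_eq]; exact h1
    rw [map_mul, map_mul, map_mul] at h1'
    -- `comm * (c₀ * (c₁ * cs)) = 1` ⇒ `c₁ = c₀⁻¹ comm⁻¹ cs⁻¹`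
    have h2 : PresentedGroup.mk ({relator g (r + 2)} : Set _) (genC (g := g) 1) =
        (PresentedGroup.mk _ (genC (g := g) 0))⁻¹ * (PresentedGroup.mk _ comm)⁻¹ *
          (PresentedGroup.mk _ cs)⁻¹ := by
      have := h1'
      rw [← mul_assoc, ← mul_assoc] at this
      -- `comm * c₀ * c₁ = cs⁻¹`
      have h3 := eq_inv_of_mul_eq_one_left this
      have h4 : PresentedGroup.mk ({relator g (r + 2)} : Set _) (genC (g := g) 1) =
          (PresentedGroup.mk _ comm * PresentedGroup.mk _ (genC (g := g) 0))⁻¹ *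
            (PresentedGroup.mk _ cs)⁻¹ := by
        rw [← h3]; group
      rw [h4, mul_inv_rev]
    exact h2
  have h₁ : ψ.comp φ = MonoidHom.id _ := by
    apply PresentedGroup.ext
    intro x
    rw [MonoidHom.comp_apply, MonoidHom.id_apply]
    change ψ (PresentedGroup.toGroup hrel (PresentedGroup.of x)) = _
    rw [PresentedGroup.toGroup.of]
    rcases x with y | j
    · simp [f, ψ]
    · refine Fin.cases ?_ (fun j' => ?_) j
      · rw [hf0, hψ0]
      · refine Fin.cases ?_ (fun j'' => ?_) j'
        · rw [show (Fin.succ 0 : Fin (r + 2)) = 1 from rfl, hf1, map_mul, map_mul, map_inv, map_inv,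
            map_inv, hψ0, hψA, hψB, hc1]
        · rw [hfs, hψs]
  have h₂ : φ.comp ψ = MonoidHom.id _ := by
    apply FreeGroup.ext_hom
    intro y
    rw [MonoidHom.comp_apply, MonoidHom.id_apply]
    rcases y with x | j
    · simp only [ψ, FreeGroup.lift_apply_of]
      change PresentedGroup.toGroup hrel (PresentedGroup.of (Sum.inl x)) = _
      rw [PresentedGroup.toGroup.of]
    · refine Fin.cases ?_ (fun j' => ?_) j
      · change PresentedGroup.toGroup hrel (ψ (FreeGroup.of (Sum.inr 0))) = _
        rw [show ψ (FreeGroup.of (Sum.inr 0)) = PresentedGroup.of (Sum.inr 0) from hψ0,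
          PresentedGroup.toGroup.of, hf0]
      · change PresentedGroup.toGroup hrel (ψ (FreeGroup.of (Sum.inr (Fin.succ j')))) = _
        rw [hψs, PresentedGroup.toGroup.of, hfs]
  refine ⟨MonoidHom.toMulEquiv φ ψ h₁ h₂, fun i => ?_, fun i => ?_, ?_, fun j => ?_⟩
  · change PresentedGroup.toGroup hrel (PresentedGroup.of (Sum.inl (i, false))) = _
    rw [PresentedGroup.toGroup.of]
  · change PresentedGroup.toGroup hrel (PresentedGroup.of (Sum.inl (i, true))) = _
    rw [PresentedGroup.toGroup.of]
  · change PresentedGroup.toGroup hrel (PresentedGroup.of (Sum.inr 0)) = _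
    rw [PresentedGroup.toGroup.of, hf0]
  · change PresentedGroup.toGroup hrel (PresentedGroup.of (Sum.inr (Fin.succ (Fin.succ j)))) = _
    rw [PresentedGroup.toGroup.of, hfs]

variable {g r}

/-- **Every puncture generator of `Γ_{g,r}` (`r ≥ 2`) belongs to a free basis**: for each `i` there is
a free basis of `Γ_{g,r}` one of whose members is `c_i` (eliminate a DIFFERENT puncture generator by the
Tietze transformations above). [cite: MochizukiSemiAnbd2006, Ex. 2.10 p.31] -/
theorem exists_freeGroupBasis_eq_c (hr : 2 ≤ r) (i : Fin r) :
    ∃ (β : Type) (bs : FreeGroupBasis β (PuncturedSurfaceGroup g r)) (k : β), bs k = c i := by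
  obtain ⟨r', rfl⟩ : ∃ r', r = r' + 2 := ⟨r - 2, by omega⟩
  refine Fin.cases ?_ (fun j => ?_) i
  · -- `i = 0`: eliminate `c₂`
    obtain ⟨e, -, -, he0, -⟩ := exists_mulEquiv_freeGroup_elim_second g r'
    refine ⟨_, FreeGroupBasis.ofRepr e, Sum.inr 0, ?_⟩
    change e.symm (FreeGroup.of (Sum.inr 0)) = c 0
    rw [← he0, MulEquiv.symm_apply_apply]
  · -- `i = j + 1`: eliminate `c₁`
    obtain ⟨e, -, -, hes⟩ := exists_mulEquiv_freeGroup_elim_first g (r' + 1)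
    refine ⟨_, FreeGroupBasis.ofRepr e, Sum.inr j, ?_⟩
    change e.symm (FreeGroup.of (Sum.inr j)) = c (Fin.succ j)
    rw [← hes j, MulEquiv.symm_apply_apply]

end Literature.GroupTheory.CombinatorialGroupTheory.PuncturedSurfaceGroup
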